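import Summits.ValiantsHypothesis.ValiantsHypothesis.Theorems.KPlusLogSqLawTropicalBSplit

/-!
# Route `KPlusLogSqLaw`, crux `TropicalB` — the SMALL-SCC (block-triangular) sector: ADDITIVITY across a block cut

HONEST FRAMING.  Helper file toward the registered stubs `stub_tropThin` / `stub_tropFat` of
`Cruxes/TropicalB/Lines/birth.lean` (crux `Summit.ValiantsHypothesis.ValiantsHypothesis.Theses.KPlusLogSqLaw.TropicalB`,
ledger item `stmt-ValiantsHypothesis-19771`, route `KPlusLogSqLaw`, DRAFT; cell `pub-symmetroid`, seat `val-sym-trop-p1`,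
2026-08-26).  It proves the statement of `TropicalB` RESTRICTED TO A SUPPORT CLASS (block-upper-triangular designs with
small diagonal blocks) with an absolute constant; it does NOT prove either stub and asserts nothing about `TropicalB` for
general supports, `KPlusLogSqLaw`, `MatrixDescartes` or `VP ≠ VNP`.

The split inequality `designRowD_split` (companion file …TropicalBSplit) with ONE state.  If no present entry of the first
column block `[0, c)` lies in a row `≥ c` (the support is block-upper-triangular at the cut `c | e`), every present term
maps the first column block onto the first `c` rows, the only state is `[0, c)`, both restricted designs are the two
diagonal blocks, and the unsigned row bound is ADDITIVE:

* `designRowD_blockCut : DesignRowD (top-left c×c block) B₁ → DesignRowD (bottom-right e×e block) B₂ → DesignRowD (whole) (B₁ + B₂)`.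

Iterating along a monotone block map `blk : Fin m → ℕ` with block-upper-triangular support (`ε a b l ≠ 0 → blk a ≤ blk b`)
and diagonal blocks of size `≤ s` (inside a block the support is arbitrary — every permutation of the block may occur):

* `designRowD_blocks : (#blocks ≤ t) → DesignRowD d v ε (t·2^(s+K) − 1)` (counting inside each block, additivity across);
* `smallBlocks_kPlusLogSq : ∃ C (= 4), ∀ m K`, every design of format `(m, K)` that is block-upper-triangular with blocks of
  size `≤ K + (log₂ m)²` has all its sign-alternating dominant chains of length `≤ 2^(C·(K + (log₂ m)²))` — the `K + log² m`
  law on the SMALL-SCC SECTOR (support digraphs whose strongly connected components are small become block-triangular after a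
  relabeling, and dominant chains are relabeling-invariant: …TropicalBRelabel).  In-window and non-counting (at `K = log₂² m`,
  blocks of size `2 log₂² m` chained triangularly carry `≈ 2^{log₂³ m}` class multisets); incomparable with the Hessenberg
  (DAG-path) sector, whose supports are one large strongly connected component.

Also: `eq_castAdd_of_strictMono`, `eq_natAdd_of_strictMono` (an increasing enumeration of an initial / final segment is the
canonical one), `designRowD_cast` (transport along `Fin.cast`).  All [folklore].
-/

set_option linter.dupNamespace false
set_option autoImplicit false

namespace Summit.ValiantsHypothesis.ValiantsHypothesis.Theorems.KPlusLogSqLaw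

open Summit.ValiantsHypothesis.ValiantsHypothesis.Theorems.MatrixDescartes.Negative
open Summit.ValiantsHypothesis.ValiantsHypothesis.Theorems.LacunarySymmetroidMatrixDescartes
open Summit.ValiantsHypothesis.ValiantsHypothesis.Theorems.LacunarySymmetroidMatrixDescartes.TropicalCensus
open scoped BigOperators
open Finset

/-! ## 1. Increasing enumerations of initial and final segments -/

/-- gap lemma: a strictly increasing map `Fin a → Fin b` grows at least like the index. [folklore] -/
theorem val_add_le_of_strictMono {a b : ℕ} (r : Fin a → Fin b) (hr : StrictMono r) :
    ∀ (i j : Fin a), i ≤ j → (r i : ℕ) + ((j : ℕ) - (i : ℕ)) ≤ (r j : ℕ) := by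
  intro i j hij
  obtain ⟨jv, hj⟩ := j
  induction jv with
  | zero =>
    have hi0 : (i : ℕ) = 0 := by rw [Fin.le_def] at hij; simpa using hij
    have : i = ⟨0, hj⟩ := Fin.ext hi0
    subst this
    simp
  | succ k ih =>
    by_cases hik : (i : ℕ) = k + 1
    · have : i = ⟨k + 1, hj⟩ := Fin.ext hik
      subst this
      simp
    · have hle : i ≤ ⟨k, by omega⟩ := by
        rw [Fin.le_def] at hij ⊢; simp only at hij ⊢; omega
      have h1 := ih (by omega) hle
      have h2 : r ⟨k, by omega⟩ < r ⟨k + 1, hj⟩ := hr (Fin.mk_lt_mk.mpr (Nat.lt_succ_self k))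
      rw [Fin.lt_def] at h2
      simp only at h1 ⊢
      omega

/-- an increasing enumeration `Fin c → Fin (c+e)` of rows all `< c` is `Fin.castAdd e`. [folklore] -/
theorem eq_castAdd_of_strictMono {c e : ℕ} (r : Fin c → Fin (c + e)) (hr : StrictMono r)
    (hlt : ∀ i, (r i : ℕ) < c) : ∀ i, r i = Fin.castAdd e i := by
  intro i
  apply Fin.ext
  rw [Fin.val_castAdd]
  rcases Nat.eq_zero_or_pos c with hc | hc
  · exact absurd i.isLt (by omega)
  have h0 := val_add_le_of_strictMono r hr ⟨0, hc⟩ i (by rw [Fin.le_def]; exact Nat.zero_le _)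
  have h1 := val_add_le_of_strictMono r hr i ⟨c - 1, by omega⟩ (by rw [Fin.le_def]; simp only; omega)
  have h2 := hlt ⟨c - 1, by omega⟩
  simp only at h0 h1
  omega

/-- an increasing enumeration `Fin e → Fin (c+e)` of rows all `≥ c` is `Fin.natAdd c`. [folklore] -/
theorem eq_natAdd_of_strictMono {c e : ℕ} (r : Fin e → Fin (c + e)) (hr : StrictMono r)
    (hge : ∀ i, c ≤ (r i : ℕ)) : ∀ i, r i = Fin.natAdd c i := by
  intro i
  apply Fin.ext
  rw [Fin.val_natAdd]
  rcases Nat.eq_zero_or_pos e with he | he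
  · exact absurd i.isLt (by omega)
  have h0 := val_add_le_of_strictMono r hr ⟨0, he⟩ i (by rw [Fin.le_def]; exact Nat.zero_le _)
  have h1 := val_add_le_of_strictMono r hr i ⟨e - 1, by omega⟩ (by rw [Fin.le_def]; simp only; omega)
  have h2 := (r ⟨e - 1, by omega⟩).isLt
  have h3 := hge ⟨0, he⟩
  simp only at h0 h1
  omega

/-- transport of the unsigned row bound along `Fin.cast`. [folklore] -/
theorem designRowD_cast {m m' K : ℕ} (h : m' = m) (d : Fin K → ℕ) (v ε : Fin m → Fin m → Fin K → ℤ) {B : ℕ}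
    (hD : DesignRowD d (fun a b l => v (Fin.cast h a) (Fin.cast h b) l) (fun a b l => ε (Fin.cast h a) (Fin.cast h b) l) B) :
    DesignRowD d v ε B := by
  subst h
  exact hD

/-! ## 2. Additivity across a block-triangular cut -/

section BlockCut

variable {c e K : ℕ}

/-- **Additivity across a block cut.**  If no present entry of the first column block lies in a row `≥ c`, the unsigned
row bound of the design is at most the SUM of the unsigned row bounds of its two diagonal blocks. [folklore] -/
theorem designRowD_blockCut (d : Fin K → ℕ) (v ε : Fin (c + e) → Fin (c + e) → Fin K → ℤ)
    (hblk : ∀ (a : Fin (c + e)) (j : Fin c) (l : Fin K), ε a (Fin.castAdd e j) l ≠ 0 → (a : ℕ) < c) {B₁ B₂ : ℕ}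
    (h₁ : DesignRowD d (fun i j l => v (Fin.castAdd e i) (Fin.castAdd e j) l)
      (fun i j l => ε (Fin.castAdd e i) (Fin.castAdd e j) l) B₁)
    (h₂ : DesignRowD d (fun i j l => v (Fin.natAdd c i) (Fin.natAdd c j) l)
      (fun i j l => ε (Fin.natAdd c i) (Fin.natAdd c j) l) B₂) :
    DesignRowD d v ε (B₁ + B₂) := by
  classical
  set R₀ : Finset (Fin (c + e)) := (univ : Finset (Fin c)).image (Fin.castAdd e) with hR₀
  have hR₀card : R₀.card = c := by
    rw [hR₀, card_image_of_injective _ (Fin.castAdd_injective _ _), card_univ, Fintype.card_fin]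
  have hmemR₀ : ∀ x : Fin (c + e), x ∈ R₀ ↔ (x : ℕ) < c := by
    intro x
    constructor
    · intro hx
      obtain ⟨j, _, rfl⟩ := mem_image.mp hx
      rw [Fin.val_castAdd]; exact j.isLt
    · intro hx
      exact mem_image.mpr ⟨⟨x, hx⟩, mem_univ _, Fin.ext (by simp)⟩
  have hsplit := designRowD_split d v ε {R₀} (fun R hR => by rw [mem_singleton.mp hR]; exact hR₀card)
    (B₁ := B₁) (B₂ := B₂) ?_ ?_ ?_
  · refine designRowD_mono ?_ hsplit
    rw [card_singleton]; omega
  · intro R hR r hr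
    rw [mem_singleton] at hR
    subst hR
    have hr' : ∀ i, r i = Fin.castAdd e i :=
      eq_castAdd_of_strictMono r r.strictMono (fun i => (hmemR₀ _).mp (hr i))
    have ev : (fun i j l => v (r i) (Fin.castAdd e j) l) = fun i j l => v (Fin.castAdd e i) (Fin.castAdd e j) l := by
      funext i j l; rw [hr']
    have eε : (fun i j l => ε (r i) (Fin.castAdd e j) l) = fun i j l => ε (Fin.castAdd e i) (Fin.castAdd e j) l := by
      funext i j l; rw [hr']
    rw [ev, eε]; exact h₁
  · intro R hR r hr
    rw [mem_singleton] at hR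
    subst hR
    have hr' : ∀ i, r i = Fin.natAdd c i :=
      eq_natAdd_of_strictMono r r.strictMono (fun i => by
        by_contra hlt
        exact hr i ((hmemR₀ _).mpr (by omega)))
    have ev : (fun i j l => v (r i) (Fin.natAdd c j) l) = fun i j l => v (Fin.natAdd c i) (Fin.natAdd c j) l := by
      funext i j l; rw [hr']
    have eε : (fun i j l => ε (r i) (Fin.natAdd c j) l) = fun i j l => ε (Fin.natAdd c i) (Fin.natAdd c j) l := by
      funext i j l; rw [hr']
    rw [ev, eε]; exact h₂
  · intro q hq
    rw [mem_singleton]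
    apply eq_of_subset_of_card_le
    · intro x hx
      obtain ⟨j, _, rfl⟩ := mem_image.mp hx
      exact (hmemR₀ _).mpr (hblk _ j _ ((termSign_ne_zero_iff ε q).mp hq (Fin.castAdd e j)))
    · have hinj : Function.Injective fun j : Fin c => q.1 (Fin.castAdd e j) :=
        q.1.injective.comp (Fin.castAdd_injective _ _)
      rw [hR₀card, card_image_of_injective _ hinj, card_univ, Fintype.card_fin]

end BlockCut

/-! ## 3. Block-upper-triangular designs with small diagonal blocks -/

/-- counting inside one block: a design of format `e ≤ s` has unsigned row bound `2^(s+K) − 1`. [folklore] -/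
theorem tropRowD_le_two_pow {e s K : ℕ} (he : e ≤ s) : TropRowD e K (2 ^ (s + K) - 1) := by
  refine tropRowD_mono ?_ (tropRowD_choose e K)
  have h1 : (K + e - 1).choose e ≤ 2 ^ (K + e - 1) := Nat.choose_le_two_pow _ _
  have h2 : 2 ^ (K + e - 1) ≤ 2 ^ (s + K) := Nat.pow_le_pow_right (by norm_num) (by omega)
  omega

/-- **Block-upper-triangular designs.**  Let `blk : Fin m → ℕ` be monotone, let the support be block-upper-triangular
(`ε a b l ≠ 0 → blk a ≤ blk b`), let every diagonal block (fiber of `blk`) have size `≤ s`, and let there be at most `t`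
blocks.  Then the unsigned row bound is `t·2^(s+K) − 1`: counting inside the blocks, additivity across. [folklore] -/
theorem designRowD_blocks (s K : ℕ) : ∀ (t m : ℕ) (d : Fin K → ℕ) (v ε : Fin m → Fin m → Fin K → ℤ) (blk : Fin m → ℕ),
    Monotone blk → (∀ a b l, ε a b l ≠ 0 → blk a ≤ blk b) →
    (∀ x : Fin m, ((univ : Finset (Fin m)).filter fun y => blk y = blk x).card ≤ s) →
    ((univ : Finset (Fin m)).image blk).card ≤ t →
    DesignRowD d v ε (t * 2 ^ (s + K) - 1) := by
  classical
  intro t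
  induction t with
  | zero =>
    intro m d v ε blk _ _ _ hcard
    -- no block: `m = 0`
    have hm : m = 0 := by
      rcases Nat.eq_zero_or_pos m with h | h
      · exact h
      · exfalso
        have : blk ⟨0, h⟩ ∈ (univ : Finset (Fin m)).image blk := mem_image_of_mem _ (mem_univ _)
        rw [Nat.le_zero, card_eq_zero] at hcard
        rw [hcard] at this
        exact absurd this (by simp)
    subst hm
    exact designRowD_mono (Nat.zero_le _) (tropRowD_size_zero K 0 d v ε)
  | succ t ih =>
    intro m d v ε blk hmono hsupp hsize hcard
    rcases Nat.eq_zero_or_pos m with hm | hm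
    · subst hm
      exact designRowD_mono (Nat.zero_le _) (tropRowD_size_zero K 0 d v ε)
    -- the last block
    set M := blk ⟨m - 1, by omega⟩ with hM
    have hleM : ∀ x, blk x ≤ M := fun x => hmono (by rw [Fin.le_def]; simp only; omega)
    set S := (univ : Finset (Fin m)).filter (fun x => blk x < M) with hS
    set c := S.card with hc
    -- `S` is the initial segment `[0, c)`
    have hdown : ∀ x y : Fin m, y ≤ x → x ∈ S → y ∈ S := by
      intro x y hyx hx
      rw [hS, mem_filter] at hx ⊢
      exact ⟨mem_univ _, lt_of_le_of_lt (hmono hyx) hx.2⟩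
    have hSiff : ∀ x : Fin m, x ∈ S ↔ (x : ℕ) < c := by
      intro x
      constructor
      · intro hx
        have hsub : Iic x ⊆ S := fun y hy => hdown x y (mem_Iic.mp hy) hx
        have := card_le_card hsub
        rw [Fin.card_Iic] at this
        omega
      · intro hx
        by_contra hxS
        have hsub : S ⊆ Iio x := by
          intro y hy
          rw [mem_Iio]
          by_contra hyx
          push Not at hyx
          exact hxS (hdown y x hyx hy)
        have := card_le_card hsub
        rw [Fin.card_Iio] at this
        omega
    have hcm : c ≤ m := by
      have := card_le_univ S; rwa [Fintype.card_fin] at this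
    -- the complement of `S` is the fiber of `M`, of size `e ≤ s`, and it is nonempty
    have hlast : (⟨m - 1, by omega⟩ : Fin m) ∉ S := by
      rw [hS, mem_filter]; push Not; intro; exact le_rfl
    have hclt : c < m := by
      have := (hSiff ⟨m - 1, by omega⟩).not.mp hlast
      simp only at this; omega
    obtain ⟨e, he⟩ : ∃ e, c + e = m := ⟨m - c, by omega⟩
    have hes : e ≤ s := by
      -- `Sᶜ ⊆ fiber of M`
      have hsub : Sᶜ ⊆ (univ : Finset (Fin m)).filter (fun y => blk y = blk ⟨m - 1, by omega⟩) := by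
        intro x hx
        rw [mem_compl, hS, mem_filter] at hx
        push Not at hx
        exact mem_filter.mpr ⟨mem_univ _, le_antisymm (hleM x) (hx (mem_univ _))⟩
      have h1 := card_le_card hsub
      have h2 := hsize ⟨m - 1, by omega⟩
      rw [card_compl, Fintype.card_fin] at h1
      omega
    -- transport to the format `c + e`
    apply designRowD_cast he d v ε
    have hval : ∀ x : Fin (c + e), ((Fin.cast he x : Fin m) : ℕ) = (x : ℕ) := fun x => rfl
    -- the block cut
    refine designRowD_mono (show (t * 2 ^ (s + K) - 1) + (2 ^ (s + K) - 1) ≤ (t + 1) * 2 ^ (s + K) - 1 by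
      have : 1 ≤ 2 ^ (s + K) := Nat.one_le_two_pow
      rw [Nat.add_mul, one_mul]; omega) ?_
    refine designRowD_blockCut d _ _ (fun a j l hne => ?_) ?_ ?_
    · -- support: a present entry in the first column block has its row in `S`
      have h1 := hsupp _ _ _ hne
      have hj : Fin.cast he (Fin.castAdd e j) ∈ S := (hSiff _).mpr (by simp)
      have h2 : blk (Fin.cast he (Fin.castAdd e j)) < M := (mem_filter.mp hj).2
      have ha : Fin.cast he a ∈ S := by
        rw [hS, mem_filter]; exact ⟨mem_univ _, lt_of_le_of_lt h1 h2⟩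
      have := (hSiff _).mp ha
      rwa [hval] at this
    · -- top-left block: `t` blocks, by induction
      refine ih c d _ _ (fun i => blk (Fin.cast he (Fin.castAdd e i))) (fun i i' hii' => hmono ?_)
        (fun a b l hne => hsupp _ _ _ hne) (fun x => ?_) ?_
      · rw [Fin.le_def] at hii' ⊢; simpa using hii'
      · -- block sizes
        refine le_trans ?_ (hsize (Fin.cast he (Fin.castAdd e x)))
        refine card_le_card_of_injOn (fun i => Fin.cast he (Fin.castAdd e i)) (fun i hi => ?_) ?_
        · have hi' := (mem_filter.mp (mem_coe.mp hi)).2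
          exact mem_coe.mpr (mem_filter.mpr ⟨mem_univ _, hi'⟩)
        · intro i _ i' _ h
          exact Fin.castAdd_injective _ _ (Fin.cast_injective _ h)
      · -- number of blocks: the image misses `M`
        have hsub : (univ : Finset (Fin c)).image (fun i => blk (Fin.cast he (Fin.castAdd e i))) ⊆
            ((univ : Finset (Fin m)).image blk).erase M := by
          intro y hy
          obtain ⟨i, _, rfl⟩ := mem_image.mp hy
          rw [mem_erase]
          refine ⟨?_, mem_image_of_mem _ (mem_univ _)⟩
          have hi : Fin.cast he (Fin.castAdd e i) ∈ S := (hSiff _).mpr (by simp)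
          exact ne_of_lt (mem_filter.mp hi).2
        have h1 := card_le_card hsub
        have hMmem : M ∈ (univ : Finset (Fin m)).image blk := mem_image_of_mem _ (mem_univ _)
        rw [card_erase_of_mem hMmem] at h1
        omega
    · -- bottom-right block: counting
      exact tropRowD_le_two_pow hes d _ _

/-- **The `K + log² m` law on the small-block sector, with `C = 4`.**  Every design of format `(m, K)` that is
block-upper-triangular along a monotone block map with diagonal blocks of size `≤ K + (log₂ m)²` has all its
sign-alternating dominant chains of length `≤ 2^(4·(K + (log₂ m)²))`.  (Supports whose strongly connected components have
size `≤ K + log₂² m` are of this form after a relabeling; use `designRowD_of_relabel`.)  HONEST RANGE: a sector theorem; the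
crux `TropicalB` quantifies over all supports. [folklore] -/
theorem smallBlocks_kPlusLogSq : ∃ C : ℕ, ∀ (m K : ℕ) (d : Fin K → ℕ) (v ε : Fin m → Fin m → Fin K → ℤ)
    (blk : Fin m → ℕ), Monotone blk → (∀ a b l, ε a b l ≠ 0 → blk a ≤ blk b) →
    (∀ x : Fin m, ((univ : Finset (Fin m)).filter fun y => blk y = blk x).card ≤ K + Nat.log 2 m ^ 2) →
    ∀ (n : ℕ) (θ : Fin (n + 1) → ℤ) (p : Fin (n + 1) → Equiv.Perm (Fin m) × (Fin m → Fin K)),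
      StrictMono θ → (∀ k, IsDominant d v ε (θ k) (p k)) →
      (∀ k : Fin n, termSign ε (p k.castSucc) * termSign ε (p k.succ) < 0) →
      n ≤ 2 ^ (C * (K + Nat.log 2 m ^ 2)) := by
  classical
  refine ⟨4, fun m K d v ε blk hmono hsupp hsize n θ p hθ hdom halt => ?_⟩
  rcases Nat.eq_zero_or_pos K with hK | hK
  · subst hK
    exact (le_of_designRowD (tropRowD_zero m 0 d v ε) θ p hθ hdom halt).trans (Nat.zero_le _)
  set L := Nat.log 2 m with hL
  -- at most `m` blocks
  have hblocks : ((univ : Finset (Fin m)).image blk).card ≤ m := by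
    have := card_image_le (s := (univ : Finset (Fin m))) (f := blk)
    rwa [card_univ, Fintype.card_fin] at this
  have hD := designRowD_blocks (K + L ^ 2) K m m d v ε blk hmono hsupp hsize hblocks
  have hn := le_of_designRowD hD θ p hθ hdom halt
  -- arithmetic: `m·2^(K + L² + K) − 1 ≤ 2^(4(K + L²))`
  have hm : m < 2 ^ (L + 1) := hL ▸ Nat.lt_pow_succ_log_self (by norm_num) m
  have hLL : L + 1 ≤ L ^ 2 + 1 := by nlinarith [Nat.zero_le L]
  calc n ≤ m * 2 ^ (K + L ^ 2 + K) - 1 := hn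
    _ ≤ m * 2 ^ (K + L ^ 2 + K) := Nat.sub_le _ _
    _ ≤ 2 ^ (L + 1) * 2 ^ (K + L ^ 2 + K) := Nat.mul_le_mul_right _ hm.le
    _ = 2 ^ (L + 1 + (K + L ^ 2 + K)) := by rw [← pow_add]
    _ ≤ 2 ^ (4 * (K + L ^ 2)) := Nat.pow_le_pow_right (by norm_num) (by nlinarith [Nat.zero_le L, hK])

end Summit.ValiantsHypothesis.ValiantsHypothesis.Theorems.KPlusLogSqLaw
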